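/-
Copyright (c) 2026 the pub-hodgecm-mathlib formalisation cell (harness21).  Prover seat hodgecm-mathlib-R90-C133-p02 (g0), Track B ∕ R90-TF, h413 = `stmt-HodgeConjecture-24833`,
R90-TF section S8 «ContSpec-n½» (S8-R140 (α′), ONE owner; census `R90/S8/CENSUS-alphaPrime-PairTube.R90-C133-p02-g0.md`): the TRUNCATED EISENSTEIN SERIES OF A LEVEL ∕ PAIR SECTION of
`U(2,1)_{L∕L⁺}` is an `L²(X)`-HOLOMORPHIC FAMILY on the Godement tube `{Re z > 2}` — the N = 3 pair twin of ★ `exists_toLp_truncation_differentiableOn_cm_three`, modulo ONE visible letter.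
-/
import Summits.HodgeConjecture.HodgeConjecture.Theorems.K2E1MaassSelbergPairingCMThree          -- ★ THE TEMPLATE (spherical): `exists_toLp_truncation_differentiableOn_cm_three`, `differentiableOn_truncation_eisensteinSeriesU_flatSectionU_apply_cm_three`; brings ★ `differentiableOn_of_weighted_bound`, ★ `_free` decay, ★ Arthur's lemma
import Summits.HodgeConjecture.HodgeConjecture.Theorems.K2E1EisensteinConstantTermIntertwinedBoundUniformU3  -- ★ p863443 (K2E2-p12): `hMfU_level_cm_three` ∕ `hMfU_pair_cm_three` — the locally-uniform tail bound, token for token this file's `hMfU` (§3 discharges it)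
import Summits.HodgeConjecture.HodgeConjecture.Theorems.K2E1ChiTruncatedEisensteinBoundedCMThree    -- ★ p863150 (K2E2-p12): the per-`z` DOMINATION bound and `memLp_quotFun_truncation_eisensteinSeriesU_flatSectionU_level_cm_three_free`; brings ★ 3a₃, ★ p863071, ★ split
import HarnessLib

/-!
# K2·E1 ∕ R90·S8 — `K2E1ChiEisensteinPairTruncationTubeCMThree` ((α′) PAIR TUBE BRICK): `z ↦ [Λ^T E(φH^z)] ∈ L²(X, μ)` IS HOLOMORPHIC ON `{Re z > 2}` FOR EVERY LEVEL ∕ PAIR SECTION `φ`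
# of `U(2,1)_{L∕L⁺}` — modulo the locally-uniform tail bound `hMfU`

Track B ∕ R90-TF, crux h413 = `stmt-HodgeConjecture-24833`, route of record `HCCMUnconditional`; cell `hodgecm-mathlib`, R90-TF section S8 «ContSpec-n½», the (V)-road DISCHARGE chain (★ p863279
`K2E1ChiMaassSelbergTubeAssemblyCMThree`'s consumer binder `hFtube`, K2E1-p16; the tube half `(D, Fam, hFam)` of ★ p863227 §3, K2E2-p12).  THEOREMS ONLY (no `def`, no `instance`, no `notation`,
no named-fact hypothesis, no `sorry`; default heartbeats); lane `--supports stmt-HodgeConjecture-24833 --as helper` (count-neutral).  CLOSES NO SOCKET.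

THE MATHEMATICS ([MoeglinWaldspurger1995, I.2.13, II.1.7, IV.2.3]; [Arthur1980TraceFormulaII, Lemma 1.4]; [BernsteinLapid2019, §4 Claim 5]; [Rudin1991, Thm. 3.31]).  As in the ★ spherical
template, `L²`-holomorphy of `z ↦ [Λ^T E(φ_z)]` on the tube follows from (1) `Λ^T E(φ_z) ∈ L²` at each `z` (★ p863150 §2, FREE for level sections), (2) POINTWISE holomorphy of `z ↦ Λ^T E(φ_z)(x)`
(★ `differentiableOn_truncation_eisensteinSeriesU_flatSectionU_apply_cm_three`, general continuous bounded `φ`), (3) a z-LOCALLY-UNIFORM sup bound, via ★ `differentiableOn_of_weighted_bound` (`W = 1`).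
For (3) the template uses the cusp decay on a compact, free only for spherical sections; here we make ★ p863150's decay-free DOMINATION bound uniform on `V = closedBall z₀ r`, `a := Re z₀ − r > 2`,
`b := Re z₀ + r`: `Λ^T E(f_z) = E(𝟙_{H≤T}f_z) − E(𝟙_{H>T}Mf_z)` (★ split); on `{H ≤ T}`, `T ≥ 1`: `|φ H^z| ≤ M·H^a·H^{Re z − a} ≤ (M·T^{b−a})·H^{a}`, so the LOW piece is dominated — for EVERY
`z ∈ V` — by the SPHERICAL low piece at the FIXED REAL POINT `a` (★ 3a₃ `exists_tsum_enorm_lowIndicator_le_cm_three`, ★ `_free`, ★ Arthur's lemma at `a`); the HIGH piece lives one coset above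
the floor (★ `norm_eisensteinSeriesU_indicator_lt_le siegel_three`) with `‖Mf_z‖ ≤ C′` on `{T < H}` — ★ p863071 gives `C′` per `z`; its uniformity for `z` in a compact is the ONE visible letter
`hMfU` (true: `Mf_z = c(z)·(M(z)φ)·H^{2−z}` with `c, M` holomorphic on the tube; payer = ★ p863071's author or a sequel).
* §1 **`exists_norm_truncation_le_level_cm_three_uniform`** — `∀ z₀, 2 < Re z₀ → ∃ r > 0, closedBall z₀ r ⊆ {2<Re} ∧ ∃ M′, ∀ z ∈ closedBall z₀ r, ∀ g, ‖Λ^T E(φ_z) g‖ ≤ M′` (mod `hMfU`).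
* §2 HEAD **`exists_toLp_truncation_differentiableOn_level_cm_three`** (level section: continuous, bounded, left-`N(𝔸)`∕`B(L⁺)`-invariant) and **`…_pair_cm_three`** (`(χ₁,χ₂)`-pair section, `χ₂`
  automorphic): `∃ Fam : ℂ → Lp ℂ 2 μ, DifferentiableOn ℂ Fam {z | 2 < z.re} ∧ ∀ z, 2 < z.re → ⇑(Fam z) =ᵐ[μ] quotFun (Λ^T E(φ_z))` — K2E1-p16's `hFtube` BYTES by restriction.
* §3 FREE HEADS **`exists_toLp_truncation_differentiableOn_level_cm_three_free`**, **`…_pair_cm_three_free`** — `hMfU` DISCHARGED by ★ p863443 `hMfU_level_cm_three` (K2E2-p12, landed while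
  this file was in typing): the tube operator road is LETTER-FREE.
HONEST LABEL: HC_CM is proved only modulo the 7 printed citations (2 remaining named inputs: hLiu418 = `stmt-HodgeConjecture-24832`, h413 = `stmt-HodgeConjecture-24833`) until
rung 0 closes; REL ≠ ★ ≠ BUILT; §1–§2 conditional on the visible `hMfU`, §3 letter-free; asserts no named fact and closes no socket; count-neutral.

## References
* [MoeglinWaldspurger1995] C. Mœglin, J.-L. Waldspurger, *Spectral Decomposition and Eisenstein Series* (1995), I.2.13, II.1.7, IV.2.3.
* [Arthur1980TraceFormulaII] J. Arthur, *A trace formula for reductive groups II*, Compositio Math. 40 (1980), §1 Lemma 1.4.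
* [BernsteinLapid2019] J. Bernstein, E. Lapid, *On the meromorphic continuation of Eisenstein series*, J. AMS (2019), §4 Claim 5.
* [Rudin1991] W. Rudin, *Functional Analysis* (2nd ed., 1991), Thm. 3.31.
-/

set_option autoImplicit false
set_option linter.dupNamespace false  -- the mandated `…HodgeConjecture.HodgeConjecture.Cruxes.H413…` namespace repeats the summit's segment

noncomputable section

open MeasureTheory Measure NumberField IsDedekindDomain Set MulAction Filter Topology Metric
open scoped ENNReal NNReal ComplexConjugate
open Literature.MeasureTheory.Group Literature.NumberTheory
open Literature.NumberTheory.Automorphic Literature.NumberTheory.Automorphic.UnitaryGroup AdelicGroupData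
open Literature.NumberTheory.Automorphic.Arthur2013.Leaves.TECR
open Literature.NumberTheory.GaloisRepresentations (HeckeCharacter)
open Summit.HodgeConjecture.HodgeConjecture.Cruxes.H413.K2E1BorelEisensteinU
open Summit.HodgeConjecture.HodgeConjecture.Cruxes.H413.K2E1TruncatedEisensteinBoundedCMThree
open Summit.HodgeConjecture.HodgeConjecture.Cruxes.H413.K2E1TruncatedEisensteinExplicit
open Summit.HodgeConjecture.HodgeConjecture.Cruxes.H413.K2E1BLHeightPowerHolomorphicU2 (differentiableOn_of_weighted_bound)
open Summit.HodgeConjecture.HodgeConjecture.Cruxes.H413.K2E1BorelEisensteinGodementCMThree (summable_eisensteinSeriesU_flatSectionU_cm_three)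
open Summit.HodgeConjecture.HodgeConjecture.Cruxes.H413.K2E1BorelCosetsDictionary (eisensteinSeriesU_eq_tsum_arithmeticBorelQuot forall_arithmeticBorel_iff)
open Summit.HodgeConjecture.HodgeConjecture.Cruxes.H413.K2E1SphericalEisensteinResidueOrthogonalU (norm_eisensteinSeriesU_indicator_lt_le)
open Summit.HodgeConjecture.HodgeConjecture.Cruxes.H413.K2E1TruncatedEisensteinCuspOrthogonalCMThree (exists_tsum_enorm_lowIndicator_le_cm_three)
open Summit.HodgeConjecture.HodgeConjecture.Cruxes.H413.K2E1MaassSelbergPairingCMThree (exists_bound_sub_borelConstantTerm_sphericalEisenstein_cm_three_free differentiableOn_truncation_eisensteinSeriesU_flatSectionU_apply_cm_three)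
open Summit.HodgeConjecture.HodgeConjecture.Cruxes.H413.K2E1ChiTruncatedEisensteinBoundedCMThree (memLp_quotFun_truncation_eisensteinSeriesU_flatSectionU_level_cm_three_free)
open Summit.HodgeConjecture.HodgeConjecture.Cruxes.H413.K2E1CharacterEisensteinU3PairDefs
open Summit.HodgeConjecture.HodgeConjecture.Cruxes.H413.K2E1EisensteinConstantTermIntertwinedBoundUniformU3 (hMfU_level_cm_three)

namespace Summit.HodgeConjecture.HodgeConjecture.Cruxes.H413.K2E1ChiEisensteinPairTruncationTubeCMThree

variable (L : Type) [Field L] [NumberField L] [IsCMField L]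
variable [MeasurableSpace (quasiSplit (↥(maximalRealSubfield L)) L (IsCMField.complexConj L) 3).Adelic] [BorelSpace (quasiSplit (↥(maximalRealSubfield L)) L (IsCMField.complexConj L) 3).Adelic]

/-! ## §1 The z-locally-uniform domination bound -/

/-- **`‖Λ^T E(φH^z)‖_∞` IS LOCALLY UNIFORMLY BOUNDED ON THE TUBE**, modulo the locally-uniform tail bound `hMfU`: for `φ` bounded and left-`B(L⁺)`-invariant, `T ≥ 1`, every `z₀` with
`2 < Re z₀` has a radius `r > 0` with `closedBall z₀ r ⊆ {2 < Re}` and ONE bound `M′` for all `z` in the ball and all `g`.  DOMINATION (★ p863150 §1) made uniform: the low piece through the FIXED real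
point `a = Re z₀ − r` (`|φH^z| ≤ (M·T^{b−a})·H^a` on `{H ≤ T}`), the high piece one coset above the floor with `hMfU`'s constant. [cite: MoeglinWaldspurger1995, I.2.13, II.1.7] [cite: Arthur1980TraceFormulaII, §1 (Lemma 1.4)] -/
theorem exists_norm_truncation_le_level_cm_three_uniform
    (ν : Measure ↥(adelicUnipotent (↥(maximalRealSubfield L)) L (IsCMField.complexConj L) 3)) [ν.IsHaarMeasure]
    {𝓕 : Set ↥(adelicUnipotent (↥(maximalRealSubfield L)) L (IsCMField.complexConj L) 3)}
    (h𝓕N : IsFundamentalDomain ↥(rationalUnipotent (↥(maximalRealSubfield L)) L (IsCMField.complexConj L) 3) 𝓕 ν) (h𝓕c : IsCompact (closure 𝓕))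
    {φ : (quasiSplit (↥(maximalRealSubfield L)) L (IsCMField.complexConj L) 3).Adelic → ℂ} {M : ℝ} (hφM : ∀ x, ‖φ x‖ ≤ M)
    (hφB : ∀ b ∈ borelU ((IsCMField.complexConj L : L ≃ₐ[↥(maximalRealSubfield L)] L) : L →+* L) ((StdForm.antidiagonal 3).over L), ∀ x : (quasiSplit (↥(maximalRealSubfield L)) L (IsCMField.complexConj L) 3).Adelic, φ ((quasiSplit (↥(maximalRealSubfield L)) L (IsCMField.complexConj L) 3).toAdelic b * x) = φ x)
    {T : ℝ≥0} (hT : 1 ≤ T)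
    (hMfU : ∀ K : Set ℂ, IsCompact K → K ⊆ {z : ℂ | 2 < z.re} → ∃ C' : ℝ, ∀ z ∈ K, ∀ g : (quasiSplit (↥(maximalRealSubfield L)) L (IsCMField.complexConj L) 3).Adelic, T < borelHeight g →
      ‖borelConstantTerm ν 𝓕 (eisensteinSeriesU (flatSectionU φ z)) g - flatSectionU φ z g‖ ≤ C')
    {z₀ : ℂ} (hz₀ : 2 < z₀.re) :
    ∃ r : ℝ, 0 < r ∧ closedBall z₀ r ⊆ {z : ℂ | 2 < z.re} ∧ ∃ M' : ℝ, ∀ z ∈ closedBall z₀ r, ∀ g : (quasiSplit (↥(maximalRealSubfield L)) L (IsCMField.complexConj L) 3).Adelic,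
      ‖truncation ν 𝓕 T (eisensteinSeriesU (flatSectionU φ z)) g‖ ≤ M' := by
  haveI := t2Space_adeleRing_of_numberField L
  haveI := locallyCompactSpace_adeleRing' L
  haveI : T2Space (quasiSplit (↥(maximalRealSubfield L)) L (IsCMField.complexConj L) 3).Adelic := inferInstanceAs (T2Space (adelic (↥(maximalRealSubfield L)) L (IsCMField.complexConj L) 3 ((StdForm.antidiagonal 3).over L)))
  -- the ball, the real window `[a, b]`
  set r : ℝ := (z₀.re - 2) / 2 with hr
  have hr0 : 0 < r := by rw [hr]; linarith
  set a : ℝ := z₀.re - r with ha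
  set b : ℝ := z₀.re + r with hb
  have ha2 : 2 < a := by rw [ha, hr]; linarith
  have hab : a ≤ b := by rw [ha, hb]; linarith
  have hwin : ∀ z ∈ closedBall z₀ r, a ≤ z.re ∧ z.re ≤ b := by
    intro z hz
    rw [mem_closedBall, dist_eq_norm] at hz
    have h := (Complex.abs_re_le_norm (z - z₀)).trans hz
    rw [Complex.sub_re, abs_le] at h
    constructor <;> [rw [ha]; rw [hb]] <;> linarith [h.1, h.2]
  have hball : closedBall z₀ r ⊆ {z : ℂ | 2 < z.re} := fun z hz => lt_of_lt_of_le ha2 (hwin z hz).1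
  -- `0 ≤ M`, `1 ≤ T`
  have hM0 : 0 ≤ M := (norm_nonneg _).trans (hφM 1)
  have hT1 : (1 : ℝ) ≤ (T : ℝ) := by exact_mod_cast hT
  have hT0 : (0 : ℝ) < (T : ℝ) := zero_lt_one.trans_le hT1
  -- (low) the spherical constants at the fixed real point `a`, coefficient `c₀ = M·T^(b−a)`
  set c₀ : ℝ := M * (T : ℝ) ^ (b - a) with hc₀
  have hc₀0 : 0 ≤ c₀ := mul_nonneg hM0 (Real.rpow_nonneg hT0.le _)
  have hza : 2 < ((a : ℝ) : ℂ).re := by rwa [Complex.ofReal_re]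
  obtain ⟨C₁, hC₁, hmaj⟩ := exists_tsum_enorm_lowIndicator_le_cm_three L ν h𝓕N h𝓕c ((c₀ : ℝ) : ℂ) hT hza
  have hzare : 2 < ((((((a : ℝ) : ℂ)).re : ℝ) : ℂ)).re := by rwa [Complex.ofReal_re]
  obtain ⟨M₁, hM₁⟩ := exists_bound_sub_borelConstantTerm_sphericalEisenstein_cm_three_free L ν h𝓕N h𝓕c hT ((c₀ : ℝ) : ℂ) (isCompact_singleton (x := (((((a : ℝ) : ℂ)).re : ℝ) : ℂ)))
    (fun w hw => by rw [Set.mem_singleton_iff.1 hw]; exact hzare)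
  obtain ⟨M₀, hM₀⟩ := exists_norm_truncation_eisensteinSeriesU_flatSectionU_le_cm_three L ν h𝓕N hT hzare continuous_const (M := ‖((c₀ : ℝ) : ℂ)‖) (fun _ => le_rfl)
    (fun _ _ _ => rfl) (hM₁ _ (Set.mem_singleton _))
  -- (high) the visible letter on the compact ball
  obtain ⟨C', hC'⟩ := hMfU (closedBall z₀ r) (isCompact_closedBall z₀ r) hball
  refine ⟨r, hr0, hball, (max (max M₀ M₁) 0 + C₁.toReal) + max C' 0, fun z hzV y => ?_⟩
  have hz : 2 < z.re := hball hzV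
  obtain ⟨hza', hzb⟩ := hwin z hzV
  -- the section at `z`, the tail, the two pieces, their `B(L⁺)`-invariance, the Godement sum (★ p863150 §1 verbatim)
  set f : (quasiSplit (↥(maximalRealSubfield L)) L (IsCMField.complexConj L) 3).Adelic → ℂ := flatSectionU φ z with hf
  set Mf : (quasiSplit (↥(maximalRealSubfield L)) L (IsCMField.complexConj L) 3).Adelic → ℂ := fun g => borelConstantTerm ν 𝓕 (eisensteinSeriesU f) g - f g with hMf
  set f₁ : (quasiSplit (↥(maximalRealSubfield L)) L (IsCMField.complexConj L) 3).Adelic → ℂ := {g : (quasiSplit (↥(maximalRealSubfield L)) L (IsCMField.complexConj L) 3).Adelic | borelHeight g ≤ T}.indicator f with hf₁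
  set f₂ : (quasiSplit (↥(maximalRealSubfield L)) L (IsCMField.complexConj L) 3).Adelic → ℂ := {g : (quasiSplit (↥(maximalRealSubfield L)) L (IsCMField.complexConj L) 3).Adelic | T < borelHeight g}.indicator Mf with hf₂
  have hφB' : ∀ b ∈ arithmeticBorel (↥(maximalRealSubfield L)) L (IsCMField.complexConj L) 3, ∀ x : (quasiSplit (↥(maximalRealSubfield L)) L (IsCMField.complexConj L) 3).Adelic, φ ((b : (quasiSplit (↥(maximalRealSubfield L)) L (IsCMField.complexConj L) 3).Adelic) * x) = φ x := forall_arithmeticBorel_iff.2 hφB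
  have hfB : ∀ b ∈ arithmeticBorel (↥(maximalRealSubfield L)) L (IsCMField.complexConj L) 3, ∀ x : (quasiSplit (↥(maximalRealSubfield L)) L (IsCMField.complexConj L) 3).Adelic, f ((b : (quasiSplit (↥(maximalRealSubfield L)) L (IsCMField.complexConj L) 3).Adelic) * x) = f x := fun b hb x => by
    simp only [hf, flatSectionU_apply, K2E1TruncatedEisensteinExplicit.borelHeight_arithmeticBorel_mul hb, hφB' b hb x]
  have hEG : ∀ (γ : (quasiSplit (↥(maximalRealSubfield L)) L (IsCMField.complexConj L) 3).arithmeticSubgroup) (x : (quasiSplit (↥(maximalRealSubfield L)) L (IsCMField.complexConj L) 3).Adelic), eisensteinSeriesU f ((γ : (quasiSplit (↥(maximalRealSubfield L)) L (IsCMField.complexConj L) 3).Adelic) * x) = eisensteinSeriesU f x :=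
    fun γ x => eisensteinSeriesU_flatSectionU_arithmeticSubgroup_mul hφB z γ x
  have hCTB : ∀ b ∈ arithmeticBorel (↥(maximalRealSubfield L)) L (IsCMField.complexConj L) 3, ∀ x : (quasiSplit (↥(maximalRealSubfield L)) L (IsCMField.complexConj L) 3).Adelic, borelConstantTerm ν 𝓕 (eisensteinSeriesU f) ((b : (quasiSplit (↥(maximalRealSubfield L)) L (IsCMField.complexConj L) 3).Adelic) * x) = borelConstantTerm ν 𝓕 (eisensteinSeriesU f) x :=
    fun b hb x => borelConstantTerm_rational_borel_mul_of_rational_invariant ν h𝓕N hEG b hb x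
  have hMfB : ∀ b ∈ arithmeticBorel (↥(maximalRealSubfield L)) L (IsCMField.complexConj L) 3, ∀ x : (quasiSplit (↥(maximalRealSubfield L)) L (IsCMField.complexConj L) 3).Adelic, Mf ((b : (quasiSplit (↥(maximalRealSubfield L)) L (IsCMField.complexConj L) 3).Adelic) * x) = Mf x := fun b hb x => by
    show borelConstantTerm ν 𝓕 (eisensteinSeriesU f) ((b : (quasiSplit (↥(maximalRealSubfield L)) L (IsCMField.complexConj L) 3).Adelic) * x) - f ((b : (quasiSplit (↥(maximalRealSubfield L)) L (IsCMField.complexConj L) 3).Adelic) * x) = borelConstantTerm ν 𝓕 (eisensteinSeriesU f) x - f x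
    rw [hCTB b hb x, hfB b hb x]
  have hf₁B := forall_arithmeticBorel_indicator hfB fun h => h ≤ T
  have hCT : ∀ x : (quasiSplit (↥(maximalRealSubfield L)) L (IsCMField.complexConj L) 3).Adelic, T < borelHeight x → borelConstantTerm ν 𝓕 (eisensteinSeriesU f) x = f x + Mf x := fun x _ => (add_sub_cancel (f x) _).symm
  have hsum : ∀ y : (quasiSplit (↥(maximalRealSubfield L)) L (IsCMField.complexConj L) 3).Adelic, Summable fun q : Quotient (orbitRel ↥(borelU ((IsCMField.complexConj L : L ≃ₐ[↥(maximalRealSubfield L)] L) : L →+* L) ((StdForm.antidiagonal 3).over L)) ↥(unitaryGroupOfForm ((IsCMField.complexConj L : L ≃ₐ[↥(maximalRealSubfield L)] L) : L →+* L) ((StdForm.antidiagonal 3).over L))) => f ((quasiSplit (↥(maximalRealSubfield L)) L (IsCMField.complexConj L) 3).toAdelic (q.out : ↥(unitaryGroupOfForm ((IsCMField.complexConj L : L ≃ₐ[↥(maximalRealSubfield L)] L) : L →+* L) ((StdForm.antidiagonal 3).over L))) * y) :=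
    fun y => (summable_eisensteinSeriesU_flatSectionU_cm_three L hz (φ := φ) (M := M) hφM y).of_norm
  have hMfbd : ∀ g : (quasiSplit (↥(maximalRealSubfield L)) L (IsCMField.complexConj L) 3).Adelic, T < borelHeight g → ‖Mf g‖ ≤ max C' 0 := fun g hg => (hC' z hzV g hg).trans (le_max_left _ _)
  -- the low piece, dominated through the real point `a`
  have hdom : ∀ x : (quasiSplit (↥(maximalRealSubfield L)) L (IsCMField.complexConj L) 3).Adelic, ‖f₁ x‖ₑ ≤
      ‖({g : (quasiSplit (↥(maximalRealSubfield L)) L (IsCMField.complexConj L) 3).Adelic | borelHeight g ≤ T}.indicator (flatSectionU (fun _ : (quasiSplit (↥(maximalRealSubfield L)) L (IsCMField.complexConj L) 3).Adelic => ((c₀ : ℝ) : ℂ)) ((a : ℝ) : ℂ))) x‖ₑ := fun x => by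
    by_cases hx : x ∈ {g : (quasiSplit (↥(maximalRealSubfield L)) L (IsCMField.complexConj L) 3).Adelic | borelHeight g ≤ T}
    · have hH0 : (0 : ℝ) < ((borelHeight x : ℝ≥0) : ℝ) := by exact_mod_cast borelHeight_pos x
      have hHT : ((borelHeight x : ℝ≥0) : ℝ) ≤ (T : ℝ) := by exact_mod_cast (show borelHeight x ≤ T from hx)
      rw [hf₁, Set.indicator_of_mem hx, Set.indicator_of_mem hx, hf, flatSectionU_apply, flatSectionU_apply, ← ofReal_norm, ← ofReal_norm, norm_mul, norm_mul,
        Complex.norm_cpow_eq_rpow_re_of_pos hH0, Complex.norm_cpow_eq_rpow_re_of_pos hH0, Complex.ofReal_re, Complex.norm_real, Real.norm_eq_abs, abs_of_nonneg hc₀0]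
      refine ENNReal.ofReal_le_ofReal ?_
      have hsplit : ((borelHeight x : ℝ≥0) : ℝ) ^ z.re = ((borelHeight x : ℝ≥0) : ℝ) ^ a * ((borelHeight x : ℝ≥0) : ℝ) ^ (z.re - a) := by
        rw [← Real.rpow_add hH0]; congr 1; ring
      have hpow : ((borelHeight x : ℝ≥0) : ℝ) ^ (z.re - a) ≤ (T : ℝ) ^ (b - a) :=
        (Real.rpow_le_rpow hH0.le hHT (by linarith)).trans (Real.rpow_le_rpow_of_exponent_le hT1 (by linarith))
      calc ‖φ x‖ * ((borelHeight x : ℝ≥0) : ℝ) ^ z.re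
          = ‖φ x‖ * (((borelHeight x : ℝ≥0) : ℝ) ^ a * ((borelHeight x : ℝ≥0) : ℝ) ^ (z.re - a)) := by rw [hsplit]
        _ ≤ M * (((borelHeight x : ℝ≥0) : ℝ) ^ a * (T : ℝ) ^ (b - a)) :=
            mul_le_mul (hφM x) (mul_le_mul_of_nonneg_left hpow (Real.rpow_nonneg hH0.le _)) (by positivity) hM0
        _ = c₀ * ((borelHeight x : ℝ≥0) : ℝ) ^ a := by rw [hc₀]; ring
    · rw [hf₁, Set.indicator_of_notMem hx, Set.indicator_of_notMem hx]
  have hB0 : 0 ≤ max (max M₀ M₁) 0 := le_max_right _ _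
  have h₁e : ‖eisensteinSeriesU f₁ y‖ₑ ≤ ENNReal.ofReal (max (max M₀ M₁) 0 + C₁.toReal) := by
    calc ‖eisensteinSeriesU f₁ y‖ₑ
        ≤ ∑' q : Quotient (QuotientGroup.rightRel (arithmeticBorel (↥(maximalRealSubfield L)) L (IsCMField.complexConj L) 3)), ‖f₁ (((q.out : (quasiSplit (↥(maximalRealSubfield L)) L (IsCMField.complexConj L) 3).arithmeticSubgroup) : (quasiSplit (↥(maximalRealSubfield L)) L (IsCMField.complexConj L) 3).Adelic) * y)‖ₑ := by
          rw [eisensteinSeriesU_eq_tsum_arithmeticBorelQuot hf₁B y]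
          exact enorm_tsum_le_tsum_enorm
      _ ≤ ‖truncation ν 𝓕 T (eisensteinSeriesU (flatSectionU (fun _ : (quasiSplit (↥(maximalRealSubfield L)) L (IsCMField.complexConj L) 3).Adelic => ((c₀ : ℝ) : ℂ)) ((((((a : ℝ) : ℂ)).re : ℝ) : ℂ)))) y‖ₑ + C₁ := by
          refine (ENNReal.tsum_le_tsum fun q => hdom _).trans ?_
          have h := hmaj y
          rwa [Complex.ofReal_re] at h ⊢
      _ ≤ ENNReal.ofReal (max (max M₀ M₁) 0) + ENNReal.ofReal C₁.toReal := by
          refine add_le_add ?_ (by rw [ENNReal.ofReal_toReal hC₁.ne])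
          rw [← ofReal_norm]
          exact ENNReal.ofReal_le_ofReal ((hM₀ y).trans (le_max_left _ _))
      _ = ENNReal.ofReal (max (max M₀ M₁) 0 + C₁.toReal) := (ENNReal.ofReal_add hB0 ENNReal.toReal_nonneg).symm
  have h₁ : ‖eisensteinSeriesU f₁ y‖ ≤ max (max M₀ M₁) 0 + C₁.toReal := by
    rw [← ofReal_norm, ENNReal.ofReal_le_ofReal_iff (add_nonneg hB0 ENNReal.toReal_nonneg)] at h₁e
    exact h₁e
  -- the high piece, one coset above the floor
  have h₂ : ‖eisensteinSeriesU f₂ y‖ ≤ max C' 0 := norm_eisensteinSeriesU_indicator_lt_le siegel_three hT hMfB (le_max_right _ _) hMfbd y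
  -- the split
  rw [truncation_eisensteinSeriesU_eq_three (ν := ν) (𝓕 := 𝓕) hT hfB hMfB hCT (hsum y)]
  exact (norm_sub_le _ _).trans (add_le_add h₁ h₂)

/-! ## §2 HEAD: the truncated Eisenstein series of a level ∕ pair section is an `L²(X)`-holomorphic family on the tube -/

/-- **THE TRUNCATED EISENSTEIN SERIES OF A LEVEL SECTION IS AN `L²(X)`-HOLOMORPHIC FAMILY ON `{Re z > 2}`** (mod `hMfU`): for `φ` continuous, bounded, left-`N(𝔸)`∕`B(L⁺)`-invariant, `T ≥ 1`,
`(ν, 𝓕)` as usual and ANY finite measure `μ` on the automorphic quotient, there is `Fam : ℂ → L²(X, μ)` with `Fam z = [Λ^T E(φH^z)]` a.e. for `Re z > 2`, complex differentiable on `{Re z > 2}` —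
★ `differentiableOn_of_weighted_bound` (`W = 1`) on a ball around each point, fed by ★ pointwise holomorphy, §1's uniform bound and ★ p863150 §2's free `L²` membership.
[cite: BernsteinLapid2019, §4 Claim 5] [cite: MoeglinWaldspurger1995, IV.2.3] [cite: Rudin1991, Thm. 3.31] -/
theorem exists_toLp_truncation_differentiableOn_level_cm_three
    (ν : Measure ↥(adelicUnipotent (↥(maximalRealSubfield L)) L (IsCMField.complexConj L) 3)) [ν.IsHaarMeasure]
    {𝓕 : Set ↥(adelicUnipotent (↥(maximalRealSubfield L)) L (IsCMField.complexConj L) 3)}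
    (h𝓕N : IsFundamentalDomain ↥(rationalUnipotent (↥(maximalRealSubfield L)) L (IsCMField.complexConj L) 3) 𝓕 ν) (h𝓕c : IsCompact (closure 𝓕))
    {φ : (quasiSplit (↥(maximalRealSubfield L)) L (IsCMField.complexConj L) 3).Adelic → ℂ} (hφc : Continuous φ) {M : ℝ} (hφM : ∀ x, ‖φ x‖ ≤ M)
    (hφN : ∀ (u : ↥(adelicUnipotent (↥(maximalRealSubfield L)) L (IsCMField.complexConj L) 3)) (x : (quasiSplit (↥(maximalRealSubfield L)) L (IsCMField.complexConj L) 3).Adelic), φ ((u : (quasiSplit (↥(maximalRealSubfield L)) L (IsCMField.complexConj L) 3).Adelic) * x) = φ x)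
    (hφB : ∀ b ∈ borelU ((IsCMField.complexConj L : L ≃ₐ[↥(maximalRealSubfield L)] L) : L →+* L) ((StdForm.antidiagonal 3).over L), ∀ x : (quasiSplit (↥(maximalRealSubfield L)) L (IsCMField.complexConj L) 3).Adelic, φ ((quasiSplit (↥(maximalRealSubfield L)) L (IsCMField.complexConj L) 3).toAdelic b * x) = φ x)
    {T : ℝ≥0} (hT : 1 ≤ T)
    (hMfU : ∀ K : Set ℂ, IsCompact K → K ⊆ {z : ℂ | 2 < z.re} → ∃ C' : ℝ, ∀ z ∈ K, ∀ g : (quasiSplit (↥(maximalRealSubfield L)) L (IsCMField.complexConj L) 3).Adelic, T < borelHeight g →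
      ‖borelConstantTerm ν 𝓕 (eisensteinSeriesU (flatSectionU φ z)) g - flatSectionU φ z g‖ ≤ C')
    (μ : Measure (quasiSplit (↥(maximalRealSubfield L)) L (IsCMField.complexConj L) 3).automorphicQuotient) [IsFiniteMeasure μ] :
    ∃ Fam : ℂ → Lp ℂ 2 μ, DifferentiableOn ℂ Fam {z : ℂ | 2 < z.re} ∧
      ∀ z : ℂ, 2 < z.re → ((Fam z : Lp ℂ 2 μ) : (quasiSplit (↥(maximalRealSubfield L)) L (IsCMField.complexConj L) 3).automorphicQuotient → ℂ) =ᵐ[μ] (quasiSplit (↥(maximalRealSubfield L)) L (IsCMField.complexConj L) 3).quotFun (truncation ν 𝓕 T (eisensteinSeriesU (flatSectionU φ z))) := by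
  classical
  have hmem : ∀ z : ℂ, 2 < z.re → MemLp ((quasiSplit (↥(maximalRealSubfield L)) L (IsCMField.complexConj L) 3).quotFun (truncation ν 𝓕 T (eisensteinSeriesU (flatSectionU φ z)))) 2 μ := fun z hz =>
    memLp_quotFun_truncation_eisensteinSeriesU_flatSectionU_level_cm_three_free L ν h𝓕N h𝓕c hφc hφM hφN hφB hT hz μ 2
  refine ⟨fun z => if h : MemLp ((quasiSplit (↥(maximalRealSubfield L)) L (IsCMField.complexConj L) 3).quotFun (truncation ν 𝓕 T (eisensteinSeriesU (flatSectionU φ z)))) 2 μ then h.toLp _ else 0, ?_, fun z hz => ?_⟩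
  swap
  · dsimp only
    rw [dif_pos (hmem z hz)]
    exact MemLp.coeFn_toLp _
  intro z₀ hz₀
  have hz₀' : 2 < z₀.re := hz₀
  obtain ⟨r, hr0, hball, M', hM'⟩ := exists_norm_truncation_le_level_cm_three_uniform L ν h𝓕N h𝓕c hφM hφB hT hMfU hz₀'
  have h0V : z₀ ∈ ball z₀ r := mem_ball_self hr0
  have hIV : ball z₀ r ⊆ {z : ℂ | 2 < z.re} := fun z hz => hball (ball_subset_closedBall hz)
  have hdiffV : DifferentiableOn ℂ (fun z => if h : MemLp ((quasiSplit (↥(maximalRealSubfield L)) L (IsCMField.complexConj L) 3).quotFun (truncation ν 𝓕 T (eisensteinSeriesU (flatSectionU φ z)))) 2 μ then h.toLp _ else 0) (ball z₀ r) := by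
    refine differentiableOn_of_weighted_bound (μ := μ) (f := fun z => (quasiSplit (↥(maximalRealSubfield L)) L (IsCMField.complexConj L) 3).quotFun (truncation ν 𝓕 T (eisensteinSeriesU (flatSectionU φ z)))) isOpen_ball (fun x => ?_)
      (fun s hs => (hmem s (hIV hs)).1) (W := fun _ => (1 : ℝ)) (memLp_const 1) (C := max M' 0) (le_max_right _ _) (fun s hs x => ?_) (fun s hs => ?_)
    · exact (differentiableOn_truncation_eisensteinSeriesU_flatSectionU_apply_cm_three L ν h𝓕N.nullMeasurableSet h𝓕c hT hφc hφM _).mono hIV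
    · rw [mul_one]
      exact (AdelicGroupData.norm_quotFun_le (hM' s (ball_subset_closedBall hs)) x).trans (le_max_left _ _)
    · show (((if h : MemLp ((quasiSplit (↥(maximalRealSubfield L)) L (IsCMField.complexConj L) 3).quotFun (truncation ν 𝓕 T (eisensteinSeriesU (flatSectionU φ s)))) 2 μ then h.toLp _ else 0 : Lp ℂ 2 μ)) : (quasiSplit (↥(maximalRealSubfield L)) L (IsCMField.complexConj L) 3).automorphicQuotient → ℂ) =ᵐ[μ] _
      rw [dif_pos (hmem s (hIV hs))]
      exact MemLp.coeFn_toLp _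
  exact ((hdiffV z₀ h0V).differentiableAt (isOpen_ball.mem_nhds h0V)).differentiableWithinAt

/-- **THE SAME FOR A `(χ₁, χ₂)`-PAIR SECTION** `φ` (★ `IsChiSectionPair χ₁ χ₂ φ`, `χ₂` automorphic; continuous, bounded; `T ≥ 1`), mod `hMfU` — K2E1-p16's consumer binder `hFtube` of ★ p863279 by
restriction to any `D₁`, and the tube half of ★ p863227 §3's `(D, Fam, hFam)` at `D := {2 < Re}`. [cite: BernsteinLapid2019, §4 Claim 5] [cite: MoeglinWaldspurger1995, IV.2.3] [cite: Rogawski1990, §13.9 p. 229] -/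
theorem exists_toLp_truncation_differentiableOn_pair_cm_three
    (ν : Measure ↥(adelicUnipotent (↥(maximalRealSubfield L)) L (IsCMField.complexConj L) 3)) [ν.IsHaarMeasure]
    {𝓕 : Set ↥(adelicUnipotent (↥(maximalRealSubfield L)) L (IsCMField.complexConj L) 3)}
    (h𝓕N : IsFundamentalDomain ↥(rationalUnipotent (↥(maximalRealSubfield L)) L (IsCMField.complexConj L) 3) 𝓕 ν) (h𝓕c : IsCompact (closure 𝓕))
    {χ₁ : HeckeCharacter L} {χ₂ : ↥(TorusDict.torus (IsCMField.complexConj L)) →ₜ* ℂˣ} (hχ₂ : TorusDict.IsAutomorphic (IsCMField.complexConj L) χ₂)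
    {φ : (quasiSplit (↥(maximalRealSubfield L)) L (IsCMField.complexConj L) 3).Adelic → ℂ} (hφ : IsChiSectionPair χ₁ χ₂ φ) (hφc : Continuous φ) {M : ℝ} (hφM : ∀ x, ‖φ x‖ ≤ M)
    {T : ℝ≥0} (hT : 1 ≤ T)
    (hMfU : ∀ K : Set ℂ, IsCompact K → K ⊆ {z : ℂ | 2 < z.re} → ∃ C' : ℝ, ∀ z ∈ K, ∀ g : (quasiSplit (↥(maximalRealSubfield L)) L (IsCMField.complexConj L) 3).Adelic, T < borelHeight g →
      ‖borelConstantTerm ν 𝓕 (eisensteinSeriesU (flatSectionU φ z)) g - flatSectionU φ z g‖ ≤ C')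
    (μ : Measure (quasiSplit (↥(maximalRealSubfield L)) L (IsCMField.complexConj L) 3).automorphicQuotient) [IsFiniteMeasure μ] :
    ∃ Fam : ℂ → Lp ℂ 2 μ, DifferentiableOn ℂ Fam {z : ℂ | 2 < z.re} ∧
      ∀ z : ℂ, 2 < z.re → ((Fam z : Lp ℂ 2 μ) : (quasiSplit (↥(maximalRealSubfield L)) L (IsCMField.complexConj L) 3).automorphicQuotient → ℂ) =ᵐ[μ] (quasiSplit (↥(maximalRealSubfield L)) L (IsCMField.complexConj L) 3).quotFun (truncation ν 𝓕 T (eisensteinSeriesU (flatSectionU φ z))) :=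
  exists_toLp_truncation_differentiableOn_level_cm_three L ν h𝓕N h𝓕c hφc hφM hφ.unipotent_mul (hφ.toAdelic_mul hχ₂) hT hMfU μ

/-! ## §3 FREE: `hMfU` discharged by ★ p863443 — the tube operator road is letter-free -/

/-- **THE TRUNCATED EISENSTEIN SERIES OF A LEVEL SECTION IS AN `L²(X)`-HOLOMORPHIC FAMILY ON `{Re z > 2}` — FREE** (`φ` continuous, bounded, left-`N(𝔸)`∕`B(L⁺)`-invariant; `T ≥ 1`; any finite
`μ`): §2 with `hMfU := ★ hMfU_level_cm_three`. [cite: BernsteinLapid2019, §4 Claim 5] [cite: MoeglinWaldspurger1995, II.1.7, IV.2.3] -/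
theorem exists_toLp_truncation_differentiableOn_level_cm_three_free
    (ν : Measure ↥(adelicUnipotent (↥(maximalRealSubfield L)) L (IsCMField.complexConj L) 3)) [ν.IsHaarMeasure]
    {𝓕 : Set ↥(adelicUnipotent (↥(maximalRealSubfield L)) L (IsCMField.complexConj L) 3)}
    (h𝓕N : IsFundamentalDomain ↥(rationalUnipotent (↥(maximalRealSubfield L)) L (IsCMField.complexConj L) 3) 𝓕 ν) (h𝓕c : IsCompact (closure 𝓕))
    {φ : (quasiSplit (↥(maximalRealSubfield L)) L (IsCMField.complexConj L) 3).Adelic → ℂ} (hφc : Continuous φ) {M : ℝ} (hφM : ∀ x, ‖φ x‖ ≤ M)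
    (hφN : ∀ (u : ↥(adelicUnipotent (↥(maximalRealSubfield L)) L (IsCMField.complexConj L) 3)) (x : (quasiSplit (↥(maximalRealSubfield L)) L (IsCMField.complexConj L) 3).Adelic), φ ((u : (quasiSplit (↥(maximalRealSubfield L)) L (IsCMField.complexConj L) 3).Adelic) * x) = φ x)
    (hφB : ∀ b ∈ borelU ((IsCMField.complexConj L : L ≃ₐ[↥(maximalRealSubfield L)] L) : L →+* L) ((StdForm.antidiagonal 3).over L), ∀ x : (quasiSplit (↥(maximalRealSubfield L)) L (IsCMField.complexConj L) 3).Adelic, φ ((quasiSplit (↥(maximalRealSubfield L)) L (IsCMField.complexConj L) 3).toAdelic b * x) = φ x)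
    {T : ℝ≥0} (hT : 1 ≤ T) (μ : Measure (quasiSplit (↥(maximalRealSubfield L)) L (IsCMField.complexConj L) 3).automorphicQuotient) [IsFiniteMeasure μ] :
    ∃ Fam : ℂ → Lp ℂ 2 μ, DifferentiableOn ℂ Fam {z : ℂ | 2 < z.re} ∧
      ∀ z : ℂ, 2 < z.re → ((Fam z : Lp ℂ 2 μ) : (quasiSplit (↥(maximalRealSubfield L)) L (IsCMField.complexConj L) 3).automorphicQuotient → ℂ) =ᵐ[μ] (quasiSplit (↥(maximalRealSubfield L)) L (IsCMField.complexConj L) 3).quotFun (truncation ν 𝓕 T (eisensteinSeriesU (flatSectionU φ z))) :=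
  exists_toLp_truncation_differentiableOn_level_cm_three L ν h𝓕N h𝓕c hφc hφM hφN hφB hT (hMfU_level_cm_three L ν h𝓕N h𝓕c hφc hφM hφN hφB hT) μ

/-- **THE SAME FOR A `(χ₁, χ₂)`-PAIR SECTION — FREE** (`χ₂` automorphic; `φ` continuous, bounded; `T ≥ 1`; any finite `μ`): = K2E1-p16's `hFtube` with NO letter.
[cite: BernsteinLapid2019, §4 Claim 5] [cite: MoeglinWaldspurger1995, II.1.7, IV.2.3] [cite: Rogawski1990, §13.9 p. 229] -/
theorem exists_toLp_truncation_differentiableOn_pair_cm_three_free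
    (ν : Measure ↥(adelicUnipotent (↥(maximalRealSubfield L)) L (IsCMField.complexConj L) 3)) [ν.IsHaarMeasure]
    {𝓕 : Set ↥(adelicUnipotent (↥(maximalRealSubfield L)) L (IsCMField.complexConj L) 3)}
    (h𝓕N : IsFundamentalDomain ↥(rationalUnipotent (↥(maximalRealSubfield L)) L (IsCMField.complexConj L) 3) 𝓕 ν) (h𝓕c : IsCompact (closure 𝓕))
    {χ₁ : HeckeCharacter L} {χ₂ : ↥(TorusDict.torus (IsCMField.complexConj L)) →ₜ* ℂˣ} (hχ₂ : TorusDict.IsAutomorphic (IsCMField.complexConj L) χ₂)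
    {φ : (quasiSplit (↥(maximalRealSubfield L)) L (IsCMField.complexConj L) 3).Adelic → ℂ} (hφ : IsChiSectionPair χ₁ χ₂ φ) (hφc : Continuous φ) {M : ℝ} (hφM : ∀ x, ‖φ x‖ ≤ M)
    {T : ℝ≥0} (hT : 1 ≤ T) (μ : Measure (quasiSplit (↥(maximalRealSubfield L)) L (IsCMField.complexConj L) 3).automorphicQuotient) [IsFiniteMeasure μ] :
    ∃ Fam : ℂ → Lp ℂ 2 μ, DifferentiableOn ℂ Fam {z : ℂ | 2 < z.re} ∧
      ∀ z : ℂ, 2 < z.re → ((Fam z : Lp ℂ 2 μ) : (quasiSplit (↥(maximalRealSubfield L)) L (IsCMField.complexConj L) 3).automorphicQuotient → ℂ) =ᵐ[μ] (quasiSplit (↥(maximalRealSubfield L)) L (IsCMField.complexConj L) 3).quotFun (truncation ν 𝓕 T (eisensteinSeriesU (flatSectionU φ z))) :=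
  exists_toLp_truncation_differentiableOn_level_cm_three_free L ν h𝓕N h𝓕c hφc hφM hφ.unipotent_mul (hφ.toAdelic_mul hχ₂) hT μ

end Summit.HodgeConjecture.HodgeConjecture.Cruxes.H413.K2E1ChiEisensteinPairTruncationTubeCMThree

end
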